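import Mathlib.Algebra.MvPolynomial.PDeriv
import Mathlib.RingTheory.MvPolynomial.EulerIdentity
import Mathlib.Geometry.Manifold.MFDeriv.NormedSpace
import Mathlib.Geometry.Manifold.MFDeriv.SpecificFunctions
import Literature.AlgebraicGeometry.HodgeTheory.HypersurfaceConeResidue
import Literature.Geometry.Kaehler.HolomorphicChartForms
import Literature.Geometry.Kaehler.AnalyticSet
import Literature.NumberTheory.Transcendental.ProjectiveSpace
import Literature.NumberTheory.Transcendental.AnalytificationFunctorialityProofs
import HarnessLib

/-!
# The residue form of a projective hypersurface on a holomorphic model: definition and local formula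

Family `hodge`, layer `Literature/AlgebraicGeometry/HodgeTheory`. Step S3 of the programme proving
the named fact `Voisin2003_hypersurface_residueForm` (file `HypersurfaceResidueForms`): given a
homogeneous `F ∈ ℂ[X₀, …, X_{m+1}]` of degree `d`, a manifold `M` charted on the complex normed
space `E`, and a map `ψ : M → ℙ ℂ ℂ^{m+2}` into the projective zero locus of `F` whose affine
coordinates are holomorphic, we DEFINE the complex `m`-form `residueForm ψ F P` on `M` — the
pull-back `ψ^* Res_Y(PΩ/F)` of Griffiths' residue (Voisin II, §6.1.1, §6.1.3) — by the
**choice-free cone formula** of `HypersurfaceConeResidue`: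

  `η(x)(v₁, …, v_m) = P(Z̃ x) · det(N, Z̃ x, dZ̃(x) v₁, …, dZ̃(x) v_m)`,

where `Z̃ = projLift ψ i` is the lift of `ψ` through the `i`-th standard chart (`i`-th homogeneous
coordinate normalised to `1`), `dZ̃(x) = liftDeriv ψ i x` its differential (Mathlib `mvfderiv`),
and `N = normalVec F (Z̃ x) j = e_j/∂_jF(Z̃ x)` a normal vector with `dF(Z̃ x) N = 1`; the indices
`i = residueIdx ψ x`, `j = residueJdx F (Z̃ x)` are chosen pointwise. The main result
`residueForm_eventuallyEq` PROVES that the choices do not matter: near every point, for every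
admissible fixed pair `(i, j)`, the form is given by the same formula `residueFormula ψ F P i j`
— by the independence of the normal vector (`coneResidue_add_left_eq`, with `ℓ = dF(Z̃ x)`, which
kills `Z̃ x` by Euler's identity and `range dZ̃(x)` because `F ∘ Z̃ = 0`,
`polyGrad_comp_mfderiv_projLift`) and the change of lift (`Z̃_{i'} = (Z̃_i)_{i'}⁻¹ • Z̃_i`,
product rule `mvfderiv_smul`, `coneResidue_lift_change`, and the degree count
`(d - m - 2) - (d - 1) + 1 + m = 0`, `residueFormula_eq_of_idx`). Holomorphy in charts and
non-vanishing of `residueForm` are the next steps (separate files).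

## References

* C. Voisin, *Hodge Theory and Complex Algebraic Geometry II* (2003), §6.1.1, §6.1.3.
* P. Griffiths, On the periods of certain rational integrals I, Ann. of Math. 90 (1969), §8.
-/

noncomputable section

open scoped Manifold ContDiff Topology LinearAlgebra.Projectivization
open Set Filter Projectivization

namespace Literature.AlgebraicGeometry.HodgeTheory

open Literature.NumberTheory.Transcendental


/-! ### The gradient of `F` and the normal vector -/

section Gradient

variable {m : ℕ}

/-- The differential `dF(z) = Σ_j ∂_jF(z) dX_j` of the polynomial function `z ↦ F(z)` on
`ℂ^{m+2}`, as a continuous linear form. [folklore] -/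
def polyGrad (F : MvPolynomial (Fin (m + 2)) ℂ) (z : Fin (m + 2) → ℂ) : (Fin (m + 2) → ℂ) →L[ℂ] ℂ :=
  ∑ j, MvPolynomial.eval z (MvPolynomial.pderiv j F) •
    ContinuousLinearMap.proj (R := ℂ) (φ := fun _ : Fin (m + 2) ↦ ℂ) j

/-- `dF(z) w = Σ_j ∂_jF(z) w_j`. [folklore] -/
theorem polyGrad_apply (F : MvPolynomial (Fin (m + 2)) ℂ) (z w : Fin (m + 2) → ℂ) :
    polyGrad F z w = ∑ j, MvPolynomial.eval z (MvPolynomial.pderiv j F) * w j := by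
  simp [polyGrad]

/-- `polyGrad F z` is the (strict) Fréchet derivative of `z ↦ F(z)`
(`MvPolynomial.hasStrictFDerivAt_eval`). [folklore] -/
theorem hasStrictFDerivAt_eval_polyGrad (F : MvPolynomial (Fin (m + 2)) ℂ) (z : Fin (m + 2) → ℂ) :
    HasStrictFDerivAt (fun v ↦ MvPolynomial.eval v F) (polyGrad F z) z :=
  MvPolynomial.hasStrictFDerivAt_eval F z

/-- **Euler's identity**: `dF(z) z = d · F(z)` for `F` homogeneous of degree `d`
(Mathlib `MvPolynomial.IsHomogeneous.sum_X_mul_pderiv`). [folklore] -/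
theorem polyGrad_apply_self {F : MvPolynomial (Fin (m + 2)) ℂ} {d : ℕ} (hF : F.IsHomogeneous d)
    (z : Fin (m + 2) → ℂ) : polyGrad F z z = d * MvPolynomial.eval z F := by
  have h := congrArg (MvPolynomial.eval z) hF.sum_X_mul_pderiv
  simp only [map_sum, map_mul, MvPolynomial.eval_X, nsmul_eq_mul, map_natCast] at h
  rw [polyGrad_apply, ← h]
  exact Finset.sum_congr rfl fun j _ ↦ mul_comm _ _

/-- Homogeneity of the gradient: `dF(c z) = c^{d-1} dF(z)` (the partial derivatives are
homogeneous of degree `d - 1`, Mathlib `MvPolynomial.IsHomogeneous.pderiv`). [folklore] -/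
theorem polyGrad_smul {F : MvPolynomial (Fin (m + 2)) ℂ} {d : ℕ} (hF : F.IsHomogeneous d) (c : ℂ)
    (z : Fin (m + 2) → ℂ) : polyGrad F (c • z) = c ^ (d - 1) • polyGrad F z := by
  ext w
  simp only [polyGrad_apply, FunLike.coe_smul, Pi.smul_apply, smul_eq_mul,
    Finset.mul_sum]
  refine Finset.sum_congr rfl fun j _ ↦ ?_
  rw [eval_smul_of_isHomogeneous hF.pderiv, mul_assoc]

/-- The normal vector `N_j = e_j / ∂_jF(z)` (meaningful where `∂_jF(z) ≠ 0`). [folklore] -/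
def normalVec (F : MvPolynomial (Fin (m + 2)) ℂ) (z : Fin (m + 2) → ℂ) (j : Fin (m + 2)) :
    Fin (m + 2) → ℂ :=
  (MvPolynomial.eval z (MvPolynomial.pderiv j F))⁻¹ • Pi.single j 1

/-- `dF(z) N_j = 1` where `∂_jF(z) ≠ 0`. [folklore] -/
theorem polyGrad_normalVec {F : MvPolynomial (Fin (m + 2)) ℂ} {z : Fin (m + 2) → ℂ} {j : Fin (m + 2)}
    (h : MvPolynomial.eval z (MvPolynomial.pderiv j F) ≠ 0) : polyGrad F z (normalVec F z j) = 1 := by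
  rw [polyGrad_apply, normalVec]
  simp [Pi.single_apply, h]

/-- Homogeneity of the normal vector: `N_j(c z) = (c^{d-1})⁻¹ N_j(z)`. [folklore] -/
theorem normalVec_smul {F : MvPolynomial (Fin (m + 2)) ℂ} {d : ℕ} (hF : F.IsHomogeneous d) (c : ℂ)
    (z : Fin (m + 2) → ℂ) (j : Fin (m + 2)) :
    normalVec F (c • z) j = (c ^ (d - 1))⁻¹ • normalVec F z j := by
  rw [normalVec, normalVec, eval_smul_of_isHomogeneous hF.pderiv, mul_inv, smul_smul]

end Gradient

/-! ### Lifts of `ψ` through the standard charts -/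

section Lift

variable {m : ℕ} {M : Type*} (ψ : M → ℙ ℂ (Fin (m + 2) → ℂ))

/-- The affine coordinates of `ψ x` in the `i`-th standard chart `U_i = {z_i ≠ 0}` of
`ℙ ℂ ℂ^{m+2}` (junk off `ψ⁻¹(U_i)`). [folklore] -/
def affineCoord (i : Fin (m + 2)) (x : M) : Fin (m + 1) → ℂ :=
  (stdChart i : OpenPartialHomeomorph (ℙ ℂ (Fin (m + 2) → ℂ)) (Fin (m + 1) → ℂ)) (ψ x)

/-- The **lift** `Z̃_i(x) = (u₀, …, 1, …, u_m)` of `ψ x` to `ℂ^{m+2} ∖ {0}` through the `i`-th chart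
(a `1` inserted in position `i` among the affine coordinates): a representative of `ψ x` on
`ψ⁻¹(U_i)`, holomorphic when the affine coordinates are. [folklore] -/
def projLift (i : Fin (m + 2)) (x : M) : Fin (m + 2) → ℂ := Fin.insertNth i 1 (affineCoord ψ i x)

/-- The `i`-th coordinate of the `i`-th lift is `1`. [folklore] -/
theorem projLift_apply_self (i : Fin (m + 2)) (x : M) : projLift ψ i x i = 1 := by
  simp [projLift]

/-- The lifts are non-zero vectors. [folklore] -/
theorem projLift_ne_zero (i : Fin (m + 2)) (x : M) : projLift ψ i x ≠ 0 := by
  intro h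
  have := congrFun h i
  rw [projLift_apply_self] at this
  exact one_ne_zero this

/-- On `ψ⁻¹(U_i)` the lift `Z̃_i(x)` represents `ψ x` (`stdChartInv_stdChartFun`). [folklore] -/
theorem mk_projLift {i : Fin (m + 2)} {x : M}
    (hx : ψ x ∈ (stdChart i : OpenPartialHomeomorph (ℙ ℂ (Fin (m + 2) → ℂ)) (Fin (m + 1) → ℂ)).source) :
    Projectivization.mk ℂ (projLift ψ i x) (projLift_ne_zero ψ i x) = ψ x := by
  have h := stdChartInv_stdChartFun i hx
  rw [stdChartInv] at h
  exact h

/-- **Change of lift**: on `ψ⁻¹(U_i ∩ U_{i'})`, `Z̃_{i'} = (Z̃_i)_{i'}⁻¹ • Z̃_i` (two representatives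
of the same point, normalised at `i` and at `i'`). [folklore] -/
theorem projLift_eq_smul_of_mem {i i' : Fin (m + 2)} {x : M}
    (hi : ψ x ∈ (stdChart i : OpenPartialHomeomorph (ℙ ℂ (Fin (m + 2) → ℂ)) (Fin (m + 1) → ℂ)).source)
    (hi' : ψ x ∈ (stdChart i' : OpenPartialHomeomorph (ℙ ℂ (Fin (m + 2) → ℂ)) (Fin (m + 1) → ℂ)).source) :
    projLift ψ i' x = (projLift ψ i x i')⁻¹ • projLift ψ i x := by
  have h := (mk_projLift ψ hi').trans (mk_projLift ψ hi).symm
  rw [Projectivization.mk_eq_mk_iff] at h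
  obtain ⟨a, ha⟩ := h
  have hi'1 : (a : ℂ) * projLift ψ i x i' = 1 := by
    have := congrFun ha i'
    rw [Pi.smul_apply, projLift_apply_self, Units.smul_def, smul_eq_mul] at this
    exact this
  rw [← ha, Units.smul_def, eq_inv_of_mul_eq_one_left hi'1]

/-- The chart domain `M_i = ψ⁻¹(U_i)`. [folklore] -/
def liftDomain (i : Fin (m + 2)) : Set M :=
  ψ ⁻¹' (stdChart i : OpenPartialHomeomorph (ℙ ℂ (Fin (m + 2) → ℂ)) (Fin (m + 1) → ℂ)).source

/-- Membership in `liftDomain ψ i` (definitional). [folklore] -/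
theorem mem_liftDomain_iff {i : Fin (m + 2)} {x : M} :
    x ∈ liftDomain ψ i ↔
      ψ x ∈ (stdChart i : OpenPartialHomeomorph (ℙ ℂ (Fin (m + 2) → ℂ)) (Fin (m + 1) → ℂ)).source :=
  Iff.rfl

/-- Every point lies in some chart domain (some homogeneous coordinate is non-zero). [folklore] -/
theorem exists_mem_liftDomain (x : M) : ∃ i, x ∈ liftDomain ψ i := by
  obtain ⟨i, hi⟩ := exists_rep_apply_ne_zero (ψ x)
  refine ⟨i, ?_⟩
  rw [mem_liftDomain_iff, stdChart_source, ← Projectivization.mk_rep (ψ x),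
    mk_mem_stdChartSource_iff]
  exact hi

/-- **The lifts lie on the cone**: `F(Z̃_i x) = 0` on `M_i` when `ψ` lands in the projective zero
locus of the homogeneous `F`. [folklore] -/
theorem eval_projLift_eq_zero {F : MvPolynomial (Fin (m + 2)) ℂ} {d : ℕ} (hF : F.IsHomogeneous d)
    (hrange : Set.range ψ ⊆ projZeroLocus {F}) {i : Fin (m + 2)} {x : M} (hx : x ∈ liftDomain ψ i) :
    MvPolynomial.eval (projLift ψ i x) F = 0 := by
  by_cases hF0 : F = 0
  · simp [hF0]
  have hS : ∀ G ∈ ({F} : Set (MvPolynomial (Fin (m + 2)) ℂ)), G.IsHomogeneous G.totalDegree := by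
    rintro G rfl; rwa [hF.totalDegree hF0]
  have hmem : Projectivization.mk ℂ (projLift ψ i x) (projLift_ne_zero ψ i x) ∈ projZeroLocus {F} := by
    rw [mk_projLift ψ hx]; exact hrange ⟨x, rfl⟩
  exact (mem_projZeroLocus_mk_iff hS _ _).mp hmem F rfl

/-- The pointwise chosen chart index `i(x)` with `x ∈ M_{i(x)}`. [folklore] -/
def residueIdx (x : M) : Fin (m + 2) := (exists_mem_liftDomain ψ x).choose

/-- `x` lies in the chart domain of its chosen index. [folklore] -/
theorem residueIdx_spec (x : M) : x ∈ liftDomain ψ (residueIdx ψ x) :=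
  (exists_mem_liftDomain ψ x).choose_spec

end Lift

section Jdx

variable {m : ℕ}

/-- The pointwise chosen normal index `j(z)`: some `j` with `∂_jF(z) ≠ 0` if there is one (junk `0`
otherwise). [folklore] -/
def residueJdx (F : MvPolynomial (Fin (m + 2)) ℂ) (z : Fin (m + 2) → ℂ) : Fin (m + 2) := by
  classical
  exact if h : ∃ j, MvPolynomial.eval z (MvPolynomial.pderiv j F) ≠ 0 then h.choose else 0

/-- The chosen normal index is admissible when some index is. [folklore] -/
theorem residueJdx_spec {F : MvPolynomial (Fin (m + 2)) ℂ} {z : Fin (m + 2) → ℂ}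
    (h : ∃ j, MvPolynomial.eval z (MvPolynomial.pderiv j F) ≠ 0) :
    MvPolynomial.eval z (MvPolynomial.pderiv (residueJdx F z) F) ≠ 0 := by
  classical
  rw [residueJdx, dif_pos h]
  exact h.choose_spec

end Jdx

/-! ### Holomorphy of the lifts and tangency to the cone -/

section Coords

variable {m : ℕ}

/-- **Holomorphy of the affine coordinates**: every affine coordinate of `ψ` in every standard
chart is holomorphic on the corresponding chart domain (the analytic hypothesis of
`Voisin2003_hypersurface_residueForm`). [folklore] -/
def HasHolomorphicCoords (E : Type*) [NormedAddCommGroup E] [NormedSpace ℂ E] {M : Type*}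
    [TopologicalSpace M] [ChartedSpace E M] (ψ : M → ℙ ℂ (Fin (m + 2) → ℂ)) : Prop :=
  ∀ (i : Fin (m + 2)) (j : Fin (m + 1)),
    MDifferentiableOn 𝓘(ℂ, E) 𝓘(ℂ, ℂ)
      (fun x ↦ (stdChart i : OpenPartialHomeomorph (ℙ ℂ (Fin (m + 2) → ℂ)) (Fin (m + 1) → ℂ))
        (ψ x) j) (liftDomain ψ i)

end Coords

section Manifold

variable {m : ℕ} {E : Type*} [NormedAddCommGroup E] [NormedSpace ℂ E]
  {M : Type*} [TopologicalSpace M] [ChartedSpace E M]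
  (ψ : M → ℙ ℂ (Fin (m + 2) → ℂ))

/-- The chart domains are open when `ψ` is continuous. [folklore] -/
theorem isOpen_liftDomain (hψ : Continuous ψ) (i : Fin (m + 2)) : IsOpen (liftDomain ψ i) :=
  (stdChart i).open_source.preimage hψ

/-- **The lifts are holomorphic** on their chart domains (componentwise,
`Literature.Geometry.Kaehler.mdifferentiableOn_pi_space`). [folklore] -/
theorem mdifferentiableOn_projLift (hhol : HasHolomorphicCoords E ψ) (i : Fin (m + 2)) :
    MDifferentiableOn 𝓘(ℂ, E) 𝓘(ℂ, Fin (m + 2) → ℂ) (projLift ψ i) (liftDomain ψ i) := by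
  refine Literature.Geometry.Kaehler.mdifferentiableOn_pi_space.mpr fun k ↦ ?_
  refine Fin.succAboveCases i ?_ (fun j ↦ ?_) k
  · have : (fun y ↦ projLift ψ i y i) = fun _ ↦ (1 : ℂ) := by
      funext y; exact projLift_apply_self ψ i y
    rw [this]
    exact mdifferentiableOn_const
  · have : (fun y ↦ projLift ψ i y (i.succAbove j)) = fun y ↦
        (stdChart i : OpenPartialHomeomorph (ℙ ℂ (Fin (m + 2) → ℂ)) (Fin (m + 1) → ℂ)) (ψ y) j := by
      funext y; simp [projLift, affineCoord]
    rw [this]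
    exact hhol i j

/-- **The lifts are tangent to the cone**: `dF(Z̃_i x) ∘ dZ̃_i(x) = 0` on the open set `M_i`
(`F ∘ Z̃_i = 0` there; chain rule and uniqueness of the manifold derivative). [folklore] -/
theorem polyGrad_comp_mfderiv_projLift {F : MvPolynomial (Fin (m + 2)) ℂ} {d : ℕ}
    (hF : F.IsHomogeneous d) (hψ : Continuous ψ) (hrange : Set.range ψ ⊆ projZeroLocus {F})
    (hhol : HasHolomorphicCoords E ψ) {i : Fin (m + 2)} {x : M} (hx : x ∈ liftDomain ψ i) :
    (polyGrad F (projLift ψ i x)).comp (mfderiv 𝓘(ℂ, E) 𝓘(ℂ, Fin (m + 2) → ℂ) (projLift ψ i) x) = 0 := by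
  have hopen := isOpen_liftDomain ψ hψ i
  have hdiff : MDifferentiableAt 𝓘(ℂ, E) 𝓘(ℂ, Fin (m + 2) → ℂ) (projLift ψ i) x :=
    (mdifferentiableOn_projLift ψ hhol i x hx).mdifferentiableAt (hopen.mem_nhds hx)
  have h1 : HasMFDerivAt 𝓘(ℂ, E) 𝓘(ℂ, ℂ) (fun y ↦ MvPolynomial.eval (projLift ψ i y) F) x
      ((polyGrad F (projLift ψ i x)).comp
        (mfderiv 𝓘(ℂ, E) 𝓘(ℂ, Fin (m + 2) → ℂ) (projLift ψ i) x)) :=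
    (hasStrictFDerivAt_eval_polyGrad F _).hasFDerivAt.hasMFDerivAt.comp x hdiff.hasMFDerivAt
  have h2 : HasMFDerivAt 𝓘(ℂ, E) 𝓘(ℂ, ℂ) (fun y ↦ MvPolynomial.eval (projLift ψ i y) F) x
      (0 : TangentSpace 𝓘(ℂ, E) x →L[ℂ] TangentSpace 𝓘(ℂ, ℂ) (MvPolynomial.eval (projLift ψ i x) F)) := by
    have hev : (fun y ↦ MvPolynomial.eval (projLift ψ i y) F) =ᶠ[𝓝 x] fun _ ↦ 0 := by
      filter_upwards [hopen.mem_nhds hx] with y hy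
      exact eval_projLift_eq_zero ψ hF hrange hy
    exact (hasMFDerivAt_const (I := 𝓘(ℂ, E)) (I' := 𝓘(ℂ, ℂ)) (0 : ℂ) x).congr_of_eventuallyEq hev
  exact h1.mfderiv.symm.trans h2.mfderiv

/-- The differential `dZ̃_i(x)` of the lift, as a map of the plain model spaces `E →L[ℂ] ℂ^{m+2}`
(Mathlib's vector-valued manifold derivative `mvfderiv`; the tangent space of the model space `E`
at `x` is `E`). [folklore] -/
def liftDeriv (i : Fin (m + 2)) (x : M) : E →L[ℂ] (Fin (m + 2) → ℂ) :=
  show TangentSpace 𝓘(ℂ, E) x →L[ℂ] (Fin (m + 2) → ℂ) from mvfderiv 𝓘(ℂ, E) (projLift ψ i) x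

/-- `liftDeriv` is `mfderiv` on vectors. [folklore] -/
theorem liftDeriv_apply (i : Fin (m + 2)) (x : M) (v : E) :
    liftDeriv ψ i x v = mfderiv 𝓘(ℂ, E) 𝓘(ℂ, Fin (m + 2) → ℂ) (projLift ψ i) x v := rfl

/-- `liftDeriv` is `mvfderiv` (definitional, with the tangent space of `E` read as `E`). [folklore] -/
theorem liftDeriv_eq_mvfderiv (i : Fin (m + 2)) (x : M) :
    liftDeriv ψ i x =
      (show E →L[ℂ] (Fin (m + 2) → ℂ) from mvfderiv 𝓘(ℂ, E) (projLift ψ i) x) := rfl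

/-- **Product rule for proportional lifts**: if `Z̃_{i'} = a • Z̃_i` near `x`, then
`dZ̃_{i'}(x) = a(x) dZ̃_i(x) + da(x) ⊗ Z̃_i(x)` (Mathlib `mvfderiv_smul`, transported to plain
types). [folklore] -/
theorem liftDeriv_eq_of_smul {i i' : Fin (m + 2)} {x : M} {a : M → ℂ}
    (h : projLift ψ i' =ᶠ[𝓝 x] fun y ↦ a y • projLift ψ i y)
    (ha : MDifferentiableAt 𝓘(ℂ, E) 𝓘(ℂ, ℂ) a x)
    (hg : MDifferentiableAt 𝓘(ℂ, E) 𝓘(ℂ, Fin (m + 2) → ℂ) (projLift ψ i) x) :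
    liftDeriv ψ i' x = a x • liftDeriv ψ i x +
      (show E →L[ℂ] ℂ from mvfderiv 𝓘(ℂ, E) a x).smulRight (projLift ψ i x) := by
  have h1 : mvfderiv 𝓘(ℂ, E) (projLift ψ i') x = mvfderiv 𝓘(ℂ, E) (fun y ↦ a y • projLift ψ i y) x := by
    ext v
    simp only [mvfderiv, ContinuousLinearMap.coe_comp, Function.comp_apply, h.mfderiv_eq]
    rfl
  have h2 := mvfderiv_smul (I := 𝓘(ℂ, E)) ha hg
  rw [liftDeriv_eq_mvfderiv, liftDeriv_eq_mvfderiv]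
  exact h1.trans h2

/-! ### The residue form and its local formula -/

/-- **The local residue formula** with chart index `i` and normal index `j`:
`x ↦ P(Z̃_i x) · det(N_j(Z̃_i x), Z̃_i x, dZ̃_i(x) ·)` (`coneResidue` of
`HypersurfaceConeResidue`), a continuous `ℂ`-alternating `m`-form on `E`; the value at `x` of
`ψ^* Res_Y(PΩ/F)` computed with these indices (Voisin II, §6.1.3: `Res_Y(PΩ/F)` is locally
`± P dx_{K}/(∂f/∂x_j)`). [cite: VoisinHodgeII2003, §6.1.1 and §6.1.3] -/
def residueFormula (F P : MvPolynomial (Fin (m + 2)) ℂ) (i j : Fin (m + 2)) (x : M) :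
    E [⋀^Fin m]→L[ℂ] ℂ :=
  MvPolynomial.eval (projLift ψ i x) P •
    coneResidue (normalVec F (projLift ψ i x) j) (projLift ψ i x) (liftDeriv ψ i x)

/-- **The residue form `ψ^* Res_Y(PΩ/F)`** on `M`, as a complex `m`-form (real scalars restricted,
on the tree's carrier `Literature.Geometry.Kaehler.MForm 𝓘(ℝ, E) M ℂ m`): the local residue
formula evaluated with the pointwise chosen indices `residueIdx`, `residueJdx`; independent of
these choices by `residueForm_eventuallyEq`. [cite: VoisinHodgeII2003, §6.1.1 and §6.1.3] -/
def residueForm (F P : MvPolynomial (Fin (m + 2)) ℂ) :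
    Literature.Geometry.Kaehler.MForm 𝓘(ℝ, E) M ℂ m := fun x ↦
  show E [⋀^Fin m]→L[ℝ] ℂ from
    (residueFormula ψ F P (residueIdx ψ x) (residueJdx F (projLift ψ (residueIdx ψ x) x)) x).restrictScalars ℝ

variable {F : MvPolynomial (Fin (m + 2)) ℂ} {d : ℕ}

/-- **Independence of the normal index**: two admissible normal vectors at the same lift give the
same formula (`coneResidue_add_left_eq` with `ℓ = dF(Z̃ x) ≠ 0`, which kills `N_j - N_{j'}`,
`Z̃ x` (Euler, `F(Z̃ x) = 0`) and `range dZ̃(x)` (tangency)). [folklore] -/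
theorem residueFormula_eq_of_jdx (hF : F.IsHomogeneous d) (hψ : Continuous ψ)
    (hrange : Set.range ψ ⊆ projZeroLocus {F}) (hhol : HasHolomorphicCoords E ψ)
    (P : MvPolynomial (Fin (m + 2)) ℂ) {i j j' : Fin (m + 2)} {x : M} (hx : x ∈ liftDomain ψ i)
    (hj : MvPolynomial.eval (projLift ψ i x) (MvPolynomial.pderiv j F) ≠ 0)
    (hj' : MvPolynomial.eval (projLift ψ i x) (MvPolynomial.pderiv j' F) ≠ 0) :
    residueFormula (E := E) ψ F P i j x = residueFormula ψ F P i j' x := by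
  simp only [residueFormula]
  refine congrArg (fun A ↦ MvPolynomial.eval (projLift ψ i x) P • A) ?_
  set z := projLift ψ i x
  have hℓ : polyGrad F z ≠ 0 := fun h0 ↦ by
    have := polyGrad_normalVec hj
    rw [h0] at this
    exact zero_ne_one this
  have hN : normalVec F z j = normalVec F z j' + (normalVec F z j - normalVec F z j') := by abel
  rw [hN]
  refine coneResidue_add_left_eq (polyGrad F z : (Fin (m + 2) → ℂ) →ₗ[ℂ] ℂ) (by
    intro h; exact hℓ (ContinuousLinearMap.coe_injective h)) ?_ ?_ ?_
  · change polyGrad F z (normalVec F z j - normalVec F z j') = 0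
    rw [map_sub, polyGrad_normalVec hj, polyGrad_normalVec hj', sub_self]
  · change polyGrad F z z = 0
    rw [polyGrad_apply_self hF, eval_projLift_eq_zero ψ hF hrange hx, mul_zero]
  · intro v
    change polyGrad F z (mfderiv 𝓘(ℂ, E) 𝓘(ℂ, Fin (m + 2) → ℂ) (projLift ψ i) x v) = 0
    have := polyGrad_comp_mfderiv_projLift ψ hF hψ hrange hhol hx
    exact DFunLike.congr_fun this v

/-- **Independence of the chart index**: on `M_i ∩ M_{i'}` the formulas with lifts `Z̃_i`, `Z̃_{i'}`
agree. With `Z̃_{i'} = c • Z̃_i`, `c = (Z̃_i x)_{i'}⁻¹` (`projLift_eq_smul_of_mem`, valid near `x`),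
the product rule gives `dZ̃_{i'} = c dZ̃_i + dc ⊗ Z̃_i` (`liftDeriv_eq_of_smul`); then
`P(cz) = c^{d-m-2} P(z)`, `N(cz) = (c^{d-1})⁻¹ N(z)` (`normalVec_smul`), and
`det((c^{d-1})⁻¹N, cz, (c L + φ ⊗ z) ·) = (c^{d-1})⁻¹ c c^m det(N, z, L ·)`
(`coneResidue_smul_left/mid`, `coneResidue_lift_change`); the exponents cancel:
`(d-m-2) + 1 + m = d - 1` — the degree-`0` homogeneity of `PΩ/F` for `deg P = d - m - 2`
(Voisin II, §6.1.3). [cite: VoisinHodgeII2003, §6.1.3] -/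
theorem residueFormula_eq_of_idx (hF : F.IsHomogeneous d) (hψ : Continuous ψ)
    (hhol : HasHolomorphicCoords E ψ)
    {P : MvPolynomial (Fin (m + 2)) ℂ} (hP : P.IsHomogeneous (d - (m + 2))) (hd : m + 2 ≤ d)
    {i i' j : Fin (m + 2)} {x : M} (hi : x ∈ liftDomain ψ i) (hi' : x ∈ liftDomain ψ i') :
    residueFormula (E := E) ψ F P i' j x = residueFormula ψ F P i j x := by
  set z := projLift ψ i x with hz
  set c : ℂ := (z i')⁻¹ with hc
  have hzi' : z i' ≠ 0 := by
    intro h0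
    have := projLift_eq_smul_of_mem ψ hi hi'
    rw [← hz, h0, inv_zero, zero_smul] at this
    exact projLift_ne_zero ψ i' x this
  have hc0 : c ≠ 0 := inv_ne_zero hzi'
  have hz' : projLift ψ i' x = c • z := projLift_eq_smul_of_mem ψ hi hi'
  -- the lifts are proportional near `x`
  set a : M → ℂ := fun y ↦ (projLift ψ i y i')⁻¹ with ha
  have hopen : IsOpen (liftDomain ψ i ∩ liftDomain ψ i') :=
    (isOpen_liftDomain ψ hψ i).inter (isOpen_liftDomain ψ hψ i')
  have hev : projLift ψ i' =ᶠ[𝓝 x] fun y ↦ a y • projLift ψ i y := by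
    filter_upwards [hopen.mem_nhds ⟨hi, hi'⟩] with y hy
    exact projLift_eq_smul_of_mem ψ hy.1 hy.2
  -- differentiability of the lift and of the scalar factor
  have hgi : MDifferentiableAt 𝓘(ℂ, E) 𝓘(ℂ, Fin (m + 2) → ℂ) (projLift ψ i) x :=
    (mdifferentiableOn_projLift ψ hhol i x hi).mdifferentiableAt ((isOpen_liftDomain ψ hψ i).mem_nhds hi)
  have hcoord : MDifferentiableAt 𝓘(ℂ, E) 𝓘(ℂ, ℂ) (fun y ↦ projLift ψ i y i') x :=
    mdifferentiableWithinAt_univ.mp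
      ((Literature.Geometry.Kaehler.mdifferentiableWithinAt_pi_space (s := univ)).mp
        hgi.mdifferentiableWithinAt i')
  have ha' : MDifferentiableAt 𝓘(ℂ, E) 𝓘(ℂ, ℂ) a x :=
    (hcoord.hasMFDerivAt.inv hzi').mdifferentiableAt
  -- the product rule, then the computation
  have hL := liftDeriv_eq_of_smul ψ hev ha' hgi
  have hax : a x = c := rfl
  rw [residueFormula, residueFormula, hL, hax, hz', ← hz, normalVec_smul hF,
    eval_smul_of_isHomogeneous hP, coneResidue_smul_left, coneResidue_smul_mid,
    coneResidue_lift_change]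
  simp only [smul_smul]
  congr 1
  have hpow : c ^ (d - (m + 2)) * c * c ^ m = c ^ (d - 1) := by
    rw [← pow_succ, ← pow_add]
    congr 1
    omega
  have hne : c ^ (d - 1) ≠ 0 := pow_ne_zero _ hc0
  calc c ^ (d - (m + 2)) * MvPolynomial.eval z P * ((c ^ (d - 1))⁻¹ * (c * c ^ m))
      = MvPolynomial.eval z P * ((c ^ (d - (m + 2)) * c * c ^ m) * (c ^ (d - 1))⁻¹) := by ring
    _ = MvPolynomial.eval z P := by rw [hpow, mul_inv_cancel₀ hne, mul_one]

/-- **Local formula for the residue form.** Let `F` be homogeneous of degree `d ≥ m + 2` with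
non-vanishing gradient at the non-zero zeros of `F`, `ψ` continuous with image in the projective
zero locus of `F` and holomorphic affine coordinates, and `P` homogeneous of degree `d - m - 2`.
Then near any point `x₀`, for ANY chart index `i` with `x₀ ∈ M_i` and ANY normal index `j` with
`∂_jF(Z̃_i x₀) ≠ 0`, the residue form `residueForm ψ F P` coincides with the fixed-index formula
`residueFormula ψ F P i j` (real scalars restricted): the pointwise choices in its definition are
immaterial (`residueFormula_eq_of_jdx`, `residueFormula_eq_of_idx`; admissibility of `(i, j)` is
an open condition). This is the well-definedness of `Res_Y(PΩ/F)` (Voisin II, §6.1.1: the residue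
does not depend on the local equation and splitting). [cite: VoisinHodgeII2003, §6.1.1 and §6.1.3] -/
theorem residueForm_eventuallyEq (hF : F.IsHomogeneous d) (hψ : Continuous ψ)
    (hrange : Set.range ψ ⊆ projZeroLocus {F})
    (hjac : ∀ z : Fin (m + 2) → ℂ, z ≠ 0 → MvPolynomial.eval z F = 0 →
      ∃ j, MvPolynomial.eval z (MvPolynomial.pderiv j F) ≠ 0)
    (hhol : HasHolomorphicCoords E ψ)
    {P : MvPolynomial (Fin (m + 2)) ℂ} (hP : P.IsHomogeneous (d - (m + 2))) (hd : m + 2 ≤ d)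
    {i j : Fin (m + 2)} {x₀ : M} (hi : x₀ ∈ liftDomain ψ i)
    (hj : MvPolynomial.eval (projLift ψ i x₀) (MvPolynomial.pderiv j F) ≠ 0) :
    ∀ᶠ x in 𝓝 x₀, residueForm ψ F P x =
      (show E [⋀^Fin m]→L[ℝ] ℂ from (residueFormula ψ F P i j x).restrictScalars ℝ) := by
  have hcont : ContinuousAt (fun x ↦ MvPolynomial.eval (projLift ψ i x) (MvPolynomial.pderiv j F)) x₀ := by
    have h1 : ContinuousAt (projLift ψ i) x₀ :=
      ((mdifferentiableOn_projLift ψ hhol i).continuousOn.continuousAt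
        ((isOpen_liftDomain ψ hψ i).mem_nhds hi))
    exact (MvPolynomial.continuous_eval _).continuousAt.comp h1
  filter_upwards [(isOpen_liftDomain ψ hψ i).mem_nhds hi, hcont.eventually_ne hj] with x hxi hxj
  set i₀ := residueIdx ψ x
  have hi₀ : x ∈ liftDomain ψ i₀ := residueIdx_spec ψ x
  set z₀ := projLift ψ i₀ x
  have hz₀ : MvPolynomial.eval z₀ F = 0 := eval_projLift_eq_zero ψ hF hrange hi₀
  have hex : ∃ j, MvPolynomial.eval z₀ (MvPolynomial.pderiv j F) ≠ 0 :=
    hjac z₀ (projLift_ne_zero ψ i₀ x) hz₀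
  have hj₀ := residueJdx_spec hex
  have hjz₀ : MvPolynomial.eval z₀ (MvPolynomial.pderiv j F) ≠ 0 := by
    have h := projLift_eq_smul_of_mem ψ hi₀ hxi
    intro h0
    apply hxj
    rw [h, eval_smul_of_isHomogeneous hF.pderiv, h0, mul_zero]
  change (show E [⋀^Fin m]→L[ℝ] ℂ from
    (residueFormula ψ F P i₀ (residueJdx F z₀) x).restrictScalars ℝ) = _
  rw [residueFormula_eq_of_jdx ψ hF hψ hrange hhol P hi₀ hj₀ hjz₀,
    ← residueFormula_eq_of_idx ψ hF hψ hhol hP hd hi₀ hxi]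

end Manifold

end Literature.AlgebraicGeometry.HodgeTheory

end
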